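import Mathlib
import HarnessLib
import Summits.NavierStokesRegularity.NavierStokesRegularity.Theorems.TaylorModelRungThreeCertificateFormatVGrowthC
import Summits.NavierStokesRegularity.NavierStokesRegularity.Theorems.TaylorModelRungThreeCertificateFormatVGrowthRun

/-!
# Crux K1b-DR (stmt-NavierStokesRegularity-23954), line `taylor-model` — v3 growth checker VARIANT C, SOUNDNESS part 1:
# the chunk run (tm-g4 g5)

For `…CertificateFormatVGrowthC` (interval chunk transfers): field reductions of `gctxC`, `facOf_gctxC` (the factor map is v1's),
`RSarr_getD` (the shared products are the `RS`), `W_gctxC` (the context's transported start vectors ARE `wVecC`), and — verbatim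
along v1's `growthRun_sound` (same `GCtx.step`, same product invariant `pre_invariant`) — **`growthRunC_sound`**,
**`growthRangeC_sound`**, **`claimsC_sound`**: a `true` chunk run certifies, for every sub-step of the chunk, the chain Boolean, the
caller's predicate, `0 ≤ L1_s ≤ gL1[s]`, the pair tests of all pairs `(a', s+1)` with the factors of the TRUE products `prodM`
(split factors with `wVecC` for earlier chunks), and at the chunk end the interval claim `prodM (qL) L ⊆ T_q` and the start-vector
claims `ũ`. MODEL-lattice bookkeeping only (rung TL-M3); nothing here is a statement about the Navier–Stokes equations.
-/

-- the sub-problem namespace repeats the summit name by design (D-0017)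
set_option linter.dupNamespace false

namespace Summit.NavierStokesRegularity.NavierStokesRegularity.Theorems.TaylorModelCert

open scoped BigOperators

namespace CertTablesV

variable {TV : CertTablesV} {kitOf : ℕ → CoreKit} {wT : ℕ → Array Dyad} {sc : ScalarsV}

/-! ### Field reductions -/

/-- [folklore] -/ theorem gctxC_n (j L q : ℕ) : (TV.gctxC j L q).n = TV.base.n := rfl
/-- [folklore] -/ theorem gctxC_prec (j L q : ℕ) : (TV.gctxC j L q).prec = TV.prec := rfl
/-- [folklore] -/ theorem gctxC_ωinvhi (j L q : ℕ) : (TV.gctxC j L q).ωinvhi = TV.ωinvhiV j := rfl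
/-- [folklore] -/ theorem gctxC_ωhi (j L q : ℕ) : (TV.gctxC j L q).ωhi = TV.ωhiV j := rfl
/-- [folklore] -/ theorem gctxC_q (j L q : ℕ) : (TV.gctxC j L q).q = q := rfl
/-- [folklore] -/ theorem gctxC_L (j L q : ℕ) : (TV.gctxC j L q).L = L := rfl
/-- [folklore] -/ theorem gctxC_gL1 (j L q : ℕ) : (TV.gctxC j L q).gL1 = TV.gL1 j := rfl
/-- [folklore] -/ theorem gctxC_S (j L q : ℕ) : (TV.gctxC j L q).S = TV.S j := rfl
/-- [folklore] -/ theorem gctxC_U (j L q : ℕ) : (TV.gctxC j L q).U = TV.gU j := rfl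
/-- [folklore] -/ theorem gctxC_ΛdesLo (j L q : ℕ) :
    (TV.gctxC j L q).ΛdesLo = (IntervalD.ofQS2 TV.prec (TV.stageV j).Λdes).lo := rfl
/-- [folklore] -/ theorem gctxC_ΛLo (j L q : ℕ) :
    (TV.gctxC j L q).ΛLo = (IntervalD.ofQS2 TV.prec (TV.base.stage j).Λ).lo := rfl

/-- The factor map of the variant-C context is v1's. [folklore] -/
theorem facOf_gctxC (j L q q' : ℕ) (P : Array (Array IntervalD)) (w : Array Dyad) :
    (TV.gctxC j L q).facOf P w = (TV.gctx j L q').facOf P w := rfl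

/-- The pair test of the variant-C context is v1's. [folklore] -/
theorem pairTest_gctxC (j L q a' b : ℕ) (fac : Dyad) :
    (TV.gctxC j L q).pairTest a' b fac = (TV.gctx j L q).pairTest a' b fac := rfl

/-! ### The shared products `RSarr` are the `RS` -/

/-- `RSarr j q k` has `k + 1` entries. [folklore] -/
theorem size_RSarr (j q : ℕ) : ∀ k : ℕ, (TV.RSarr j q k).size = k + 1
  | 0 => rfl
  | k + 1 => by
    show ((TV.RSarr j q k).push _).size = k + 1 + 1
    rw [Array.size_push, size_RSarr j q k]

/-- **`(RSarr j q k)[m] = RS j q m`** for `m ≤ k`. [folklore] -/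
theorem getD_RSarr (j q : ℕ) : ∀ k m : ℕ, m ≤ k → (TV.RSarr j q k).getD m #[] = TV.RS j q m
  | 0, m, hm => by
    obtain rfl : m = 0 := Nat.le_zero.1 hm
    rfl
  | k + 1, m, hm => by
    show ((TV.RSarr j q k).push (mulII TV.base.n TV.prec ((TV.RSarr j q k).getD k #[]) (TV.gTI j (q - 1 - k)))).getD m #[] = _
    rcases Nat.lt_or_ge m (k + 1) with hlt | hge
    · have hsz : m < (TV.RSarr j q k).size := by rw [size_RSarr]; exact hlt
      rw [getD_push_lt _ _ _ hsz]
      exact getD_RSarr j q k m (by omega)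
    · have hm' : m = k + 1 := le_antisymm hm hge
      subst hm'
      have h := getD_push_size (TV.RSarr j q k)
        (mulII TV.base.n TV.prec ((TV.RSarr j q k).getD k #[]) (TV.gTI j (q - 1 - k))) #[]
      rw [size_RSarr] at h
      rw [h, getD_RSarr j q k k le_rfl]
      rfl

/-- **The context's transported start vectors are `wVecC`**: `(gctxC j L q).W[a'] = wVecC j L q a'` for `a' < qL`.
[folklore] -/
theorem W_gctxC {j L q a' : ℕ} (ha' : a' < q * L) :
    (TV.gctxC j L q).W.getD a' #[] = TV.wVecC j L q a' := by
  show (Array.ofFn (n := q * L) fun a' : Fin (q * L) =>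
      absMulVecUp TV.base.n TV.prec (((TV.RSarr j q (q - 1)).map (magM TV.base.n)).getD (q - 1 - a' / L) #[])
        (TV.gU j a')).getD a' #[] = _
  rw [getD_ofFn_lt _ ha']
  have hm : q - 1 - a' / L ≤ q - 1 := Nat.sub_le _ _
  have hlt : q - 1 - a' / L < (TV.RSarr j q (q - 1)).size := by rw [size_RSarr]; exact Nat.lt_succ_of_le hm
  rw [getD_map_of_lt (magM TV.base.n) (TV.RSarr j q (q - 1)) hlt #[] #[], getD_RSarr j q (q - 1) (q - 1 - a' / L) hm]
  rfl

/-! ### Soundness of the chunk run (variant C) -/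

/-- **`growthRunC` from the true node state certifies every sub-step it runs** (v1's `growthRun_sound` with the context
`gctxC` and the interval claims). [folklore] -/
theorem growthRunC_sound (P : ℕ → CoreOut → Bool) (j L q : ℕ) :
    ∀ (k s : ℕ) (pre : Array (Array (Array IntervalD))),
      TV.growthRunC kitOf wT P j (TV.gctxC j L q) (TV.gTI j q) k s ((TV.ctxOfW kitOf wT j).nodeAt s) pre = true →
      q * L ≤ s → pre.size = s - q * L →
      (∀ i < pre.size, pre.getD i #[] = TV.prodM kitOf wT j (q * L + i) (s - (q * L + i))) →
      (∀ i, i < k →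
        ((TV.ctxOfW kitOf wT j).subStep (s + i) ((TV.ctxOfW kitOf wT j).nodeAt (s + i))).ok = true ∧
        P (s + i) ((TV.ctxOfW kitOf wT j).subStep (s + i) ((TV.ctxOfW kitOf wT j).nodeAt (s + i))).core = true ∧
        (Dyad.ble Dyad.zero (TV.coreVW kitOf wT j (s + i)).L1 = true ∧
          Dyad.ble (TV.coreVW kitOf wT j (s + i)).L1 (dget (TV.gL1 j) (s + i)) = true) ∧
        (∀ i', i' < s + i + 1 - q * L → (TV.gctx j L q).pairTest (q * L + i') (s + i + 1)
          ((TV.gctx j L q).facOf (TV.prodM kitOf wT j (q * L + i') (s + i + 1 - (q * L + i'))) (TV.ωhiV j)) = true) ∧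
        (TV.gctx j L q).pairTest (s + i + 1) (s + i + 1) ((TV.gctx j L q).facOf (idIM TV.base.n) (TV.ωhiV j)) = true ∧
        (∀ a' < q * L, (TV.gctx j L q).pairTest a' (s + i + 1)
          ((TV.gctx j L q).facOf (TV.prodM kitOf wT j (q * L) (s + i + 1 - q * L))
            ((TV.gctxC j L q).W.getD a' #[])) = true)) ∧
      ∃ preF : Array (Array (Array IntervalD)), preF.size = s + k - q * L ∧
        (∀ i < preF.size, preF.getD i #[] = TV.prodM kitOf wT j (q * L + i) (s + k - (q * L + i))) ∧
        (TV.gctxC j L q).claimsOKC (TV.gTI j q) (s + k) preF = true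
  | 0, s, pre, h, hs, hsz, hpre => by
    refine ⟨fun i hi => absurd hi (Nat.not_lt_zero i), pre, by simpa using hsz, ?_, ?_⟩
    · simpa using hpre
    · simpa [growthRunC] using h
  | k + 1, s, pre, h, hs, hsz, hpre => by
    simp only [growthRunC, GCtx.stepF_eq, Bool.and_eq_true] at h
    obtain ⟨⟨⟨hok, hP⟩, hstep⟩, hrest⟩ := h
    have hnext : ((TV.ctxOfW kitOf wT j).subStep s ((TV.ctxOfW kitOf wT j).nodeAt s)).next =
        (TV.ctxOfW kitOf wT j).nodeAt (s + 1) := rfl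
    have hM : ((TV.ctxOfW kitOf wT j).subStep s ((TV.ctxOfW kitOf wT j).nodeAt s)).core.M = TV.Mk kitOf wT j s := rfl
    have hL : ((TV.ctxOfW kitOf wT j).subStep s ((TV.ctxOfW kitOf wT j).nodeAt s)).core.L1 = (TV.coreVW kitOf wT j s).L1 := rfl
    rw [hnext, step_fst, hM] at hrest
    rw [step_snd_iff, hM, hL] at hstep
    simp only [gctxC_n, gctxC_prec, gctxC_q, gctxC_L, gctxC_gL1, gctxC_ωhi, pairTest_gctxC, facOf_gctxC j L q q]
      at hrest hstep
    obtain ⟨hL1, hIn, hDiag, hOut⟩ := hstep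
    obtain ⟨hsz', hpre'⟩ := pre_invariant (TV := TV) (kitOf := kitOf) (wT := wT) j q L s hs pre hsz hpre
    have ih := growthRunC_sound P j L q k (s + 1) _ hrest (by omega) hsz' hpre'
    refine ⟨fun i hi => ?_, ?_⟩
    · cases i with
      | zero =>
        simp only [Nat.add_zero]
        refine ⟨hok, hP, hL1, fun i' hi' => ?_, ?_, fun a' ha' => ?_⟩
        · have hi'' : i' < ((pre.map fun P => mulII TV.base.n TV.prec (TV.Mk kitOf wT j s) P).push (TV.Mk kitOf wT j s)).size := by
            rw [hsz']; exact hi'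
          have := hIn i' hi''
          rw [hpre' i' hi''] at this
          exact this
        · exact hDiag
        · have h0 : 0 < ((pre.map fun P => mulII TV.base.n TV.prec (TV.Mk kitOf wT j s) P).push (TV.Mk kitOf wT j s)).size := by
            rw [hsz']; omega
          have := hOut a' ha'
          rw [hpre' 0 h0] at this
          simpa using this
      | succ i =>
        have := ih.1 i (Nat.lt_of_succ_lt_succ hi)
        simpa only [Nat.add_succ, Nat.succ_add, Nat.add_assoc] using this
    · obtain ⟨preF, h1, h2, h3⟩ := ih.2
      refine ⟨preF, by omega, fun i hi => ?_, ?_⟩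
      · rw [h2 i hi]; congr 1; omega
      · have e : s + 1 + k = s + (k + 1) := by omega
        rw [e] at h3; exact h3

/-- **Soundness of the variant-C growth chunk check** (from the chunk's start state). [folklore] -/
theorem growthRangeC_sound {P : ℕ → CoreOut → Bool} {j L q : ℕ} (h : TV.growthRangeC kitOf wT P j L q = true) :
    (∀ i, i < min L (TV.S j - q * L) →
        ((TV.ctxOfW kitOf wT j).subStep (q * L + i) ((TV.ctxOfW kitOf wT j).nodeAt (q * L + i))).ok = true ∧
        P (q * L + i) ((TV.ctxOfW kitOf wT j).subStep (q * L + i) ((TV.ctxOfW kitOf wT j).nodeAt (q * L + i))).core = true ∧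
        (Dyad.ble Dyad.zero (TV.coreVW kitOf wT j (q * L + i)).L1 = true ∧
          Dyad.ble (TV.coreVW kitOf wT j (q * L + i)).L1 (dget (TV.gL1 j) (q * L + i)) = true) ∧
        (∀ i', i' < q * L + i + 1 - q * L → (TV.gctx j L q).pairTest (q * L + i') (q * L + i + 1)
          ((TV.gctx j L q).facOf (TV.prodM kitOf wT j (q * L + i') (q * L + i + 1 - (q * L + i'))) (TV.ωhiV j)) = true) ∧
        (TV.gctx j L q).pairTest (q * L + i + 1) (q * L + i + 1) ((TV.gctx j L q).facOf (idIM TV.base.n) (TV.ωhiV j)) = true ∧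
        (∀ a' < q * L, (TV.gctx j L q).pairTest a' (q * L + i + 1)
          ((TV.gctx j L q).facOf (TV.prodM kitOf wT j (q * L) (q * L + i + 1 - q * L))
            ((TV.gctxC j L q).W.getD a' #[])) = true)) ∧
      ∃ preF : Array (Array (Array IntervalD)), preF.size = q * L + min L (TV.S j - q * L) - q * L ∧
        (∀ i < preF.size, preF.getD i #[] = TV.prodM kitOf wT j (q * L + i) (q * L + min L (TV.S j - q * L) - (q * L + i))) ∧
        (TV.gctxC j L q).claimsOKC (TV.gTI j q) (q * L + min L (TV.S j - q * L)) preF = true := by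
  unfold growthRangeC at h
  rw [StageCtx.startNode_eq_nodeAt] at h
  exact growthRunC_sound P j L q _ _ #[] h le_rfl (by simp) (by simp)

/-- **The claims, unpacked (variant C)**: if a later chunk exists (`(q+1)L < S`), the chunk run certified
`prodM (qL) L ⊆ T_q` (as `subsetIM`) and `(|prodM a ((q+1)L − a)|·ω↑)↑ ≤ ũ_a` coordinatewise for every start `a` of chunk `q`.
[folklore] -/
theorem claimsC_sound {P : ℕ → CoreOut → Bool} {j L q : ℕ} (h : TV.growthRangeC kitOf wT P j L q = true) (hL : 0 < L)
    (hlater : (q + 1) * L < TV.S j) :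
    subsetIM TV.base.n (TV.prodM kitOf wT j (q * L) L) (TV.gTI j q) = true ∧
    (∀ a, q * L ≤ a → a < (q + 1) * L → ∀ c < TV.base.n,
        vre (absMulVecUp TV.base.n TV.prec (magM TV.base.n (TV.prodM kitOf wT j a ((q + 1) * L - a))) (TV.ωhiV j)) c ≤
          vre (TV.gU j a) c) := by
  obtain ⟨-, preF, hsz, hpre, hcl⟩ := growthRangeC_sound (TV := TV) (kitOf := kitOf) (wT := wT) h
  have hend : (q + 1) * L = q * L + L := by ring
  have hmin : min L (TV.S j - q * L) = L := min_eq_left (by omega)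
  rw [hmin] at hsz hpre hcl
  unfold GCtx.claimsOKC at hcl
  simp only [gctxC_S, gctxC_n, gctxC_prec, gctxC_q, gctxC_L, gctxC_ωhi, gctxC_U, Bool.or_eq_true, decide_eq_true_eq,
    Bool.and_eq_true, allN_eq_true] at hcl
  rcases hcl with hS | ⟨hT, hU⟩
  · exfalso; omega
  have h0 : 0 < preF.size := by rw [hsz]; omega
  refine ⟨?_, fun a ha1 ha2 c hc => ?_⟩
  · have e := hpre 0 h0
    rw [Nat.add_zero, show q * L + L - q * L = L by omega] at e
    rw [e] at hT
    exact hT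
  · have hi : a - q * L < preF.size := by rw [hsz]; omega
    have hle := le_of_leVec (hU (a - q * L) hi) hc
    rw [hpre (a - q * L) hi] at hle
    have e1 : q * L + (a - q * L) = a := by omega
    have e2 : q * L + L - a = (q + 1) * L - a := by rw [hend]
    rw [e1, e2] at hle
    exact hle

end CertTablesV

end Summit.NavierStokesRegularity.NavierStokesRegularity.Theorems.TaylorModelCert
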